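import Literature.MathematicalPhysics.QuantumFieldTheory.Balaban1983to89.B9Eq347GlobalFromLocalZd
import Literature.MathematicalPhysics.QuantumFieldTheory.Balaban1983to89.B9Lemma21RowLetterZd

/-!
# `Balaban1983to89.B9Eq347GlobalFromLocalZdUniform` — [Balaban1985BackgroundPropagators] p. 398 l. 17–20 «(3.47) follows from (3.42) … using Lemma 2.1 of [4]»
# ON THE `ℤᵈ` FRAME WITH PRINT'S MEMBER-UNIFORM CONSTANTS: the four (3.47)-shape entries of `B9Eq347GlobalFromLocalZd` (letters `hex`, `hS` displayed there) with
# BOTH Lemma-2.1 letters DISCHARGED uniformly in the member — the cube exchange (2.60) by `B9Lemma21ShellCrossingZd.cube_exchange_of_connected` (`R = L³`) and the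
# row sum (2.61) by `B9Lemma21RowLetterZd.rowLetter261_hS` (`S = K261 N₀ d L 1 (δ₀ − κ₂)`) — on every finite member with connected block graph in print's regime
# «RM sufficiently large»: `3·log L ≤ κ₂·R⌈M⌉`, `N₀ ≤ R⌈M⌉`, `e^{−(δ₀−κ₂)}·L^{2d∕N₀} < 1`

statement-level skeleton of published theorems with citation tags; proofs where landed; nothing here is a claim about the
Yang–Mills mass gap

PDF held: `paper:balaban1985-cmp99-background-propagators` (journal page = PDF page + 388): p. 397 (3.42), p. 398 (3.47) + l. 17–20 (page images read by this seat);
`paper:balaban1984-cmp96-propagators-rt-ii` p. 234 Lemma 2.1 (2.60)–(2.61).  BY NAME: `B9Eq347GlobalFromLocalZd` (this seat g0, p589880: the four entries with the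
letters displayed), `B9Lemma21ShellCrossingZd` (p598943: (2.60) ⇒ the cube exchange letter), `B9Lemma21RowLetterZd` (INTENT-8: (2.61) ⇒ the row letter, via the
generic engine `B6Ineq261LevelGap`).

WHY THIS FILE (cell `pub-ymgap`, HUMAN RULING D-0062 ∕ D-0149; seat `pub-ymgap-dag-n06-w2` (g2), node N06 = [B9]; INTENT-9; count-neutral).  `B9Eq347GlobalFromLocalZdFinite`
(g0) inhabited the two letters of the (3.47) ⇐ (3.42) summation with crude MEMBER-DEPENDENT constants (`S = |𝔅|`, `R` = a ratio of extreme weights), labelled «NOT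
print's member-uniform statement».  With (2.60) and (2.61) now theorems of the frame (this seat's g2 files), print's actual statement follows on every finite member
whose block graph is connected and whose `RM` is large at the rates in play: the γ = −3 weighted bounds hold with the constants `B₀·L³·K261(…)`, the same for every
member `(M, i, m)` of the family with `R⌈M⌉ ≥ max(N₀, 3 log L ∕ κ₂)`.

WHAT IS PROVED (0 sorry; proof lane — no `def`).  Common data: a member `x` with finitely many blocks, `1 ≤ L`, `Sep22Zd R x`, laws (T)(V), connected block graph;
the (3.42) block `h342` of the genuine readings `GAZdOfOps … ops` at `U` with `0 ≤ B₀`; `ops.Gop U` ℝ-linear; a bond class `P` with base-block assignment `π`;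
rates `0 ≤ κ₂` with `3·log L ≤ κ₂·R⌈M⌉`, a threshold `0 < N₀ ≤ R⌈M⌉` with `e^{−(δ₀−κ₂)}·L^{2d∕N₀} < 1`; a source `f` on the class with `(L^{j}η)³·‖f(y)‖ ≤ M` (`j` the
level of `π y`; the `γ = −3` source norm).  Conclusions, at every bond `b` of the class (`j = ` level of `π b`, `K = K261 N₀ d L 1 (δ₀ − κ₂)`):
* ★★ `weight_mul_norm_gop_le_unif` — `(Lʲη)·‖(G(U)f̃)(b)‖ ≤ B₀·L³·K·M` (entry n = 0, `|Gλ|_{(−1)} ≤ …|λ|_{(−3)}`);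
* ★ `weight_mul_norm_gradGop_le_unif` — `(Lʲη)²·‖(∇_{U,ν}G(U)f̃)(b)‖ ≤ B₀·L³·K·M` (n = 1);
* ★ `weight_mul_norm_gopDiv_le_unif` — `(Lʲη)²·‖(G(U)∇*_{U,ν}f̃)(b)‖ ≤ B₀·L³·K·M` (n = 2);
* ★ `weight_mul_norm_lapGop_le_unif` — `(Lʲη)³·‖(Δ_U G(U)f̃)(b)‖ ≤ B₀·L³·K·M` (n = 3).
HONEST SCOPE.  By-name composition; the constants are uniform over the members of the family in the stated regime but `L`-dependent (`K261`, the engine's honest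
scope); connectivity, (T), (V), `Sep22Zd` DISPLAYED; `G(U)` is the letter `ops.Gop` constrained only by linearity and the (3.42) readings (inhabited trivially — the
genuine operator is dag-n06-w4's `gopZd`); the Hölder line is NOT here (its exchange letter carries the frame's `η`-scale cut-off norm, located (L-H2)).  Count-neutral;
N05∕N06 NOT discharged; one finite lattice programme at fixed `ε`; R4 closes the conditional finite-𝕋⁴ rung `BalabanLadder.UV` only; nothing continuum ∕ ℝ⁴ ∕ OS ∕
mass-gap ∕ Clay.  Unit `pub-ymgap-dag-n06-w2` (g2), 2026-08-28.
-/

noncomputable section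

namespace Literature.MathematicalPhysics.QuantumFieldTheory.Balaban1983to89.B9Eq347GlobalFromLocalZdUniform

open B8LeafModelZd (ZdIdx)
open B9SupplySockB9P3ZdLetters (OpsZd)
open B9SupplySockB9P3ZdFrame (MemberZd BSite blockZd CfgZd graphZd distZd Sep22Zd)
open B9SupplySockB9P3ZdLocalLettersOfOps (cdBZd cdsBZd lapBZd GAZdOfOps)
open B9Eq347GlobalFromLocalZd (extZd weight_mul_norm_gop_le_of_ineq342 weight_mul_norm_gradGop_le_of_ineq342
  weight_mul_norm_gopDiv_le_of_ineq342 weight_mul_norm_lapGop_le_of_ineq342)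
open B9Lemma21ShellCrossingZd (cube_exchange_of_connected)
open B9Lemma21RowLetterZd (rowLetter261_hS)
open B6Ineq261LevelGap (K261 K261_nonneg)

-- `Site` alone could resolve to the torus sites of `Setup.lean`; re-export the `ℤ^d` sites of `B7Prop1Explicit`.
export B7Prop1Explicit (Site)

variable {d : ℕ} {𝔸 : Type} [CStarAlgebra 𝔸] {L : ℕ} {len : Site d → ℝ} {x : MemberZd d L}
  (hT : ∀ y : BSite L x, blockZd L y.1.1 y.1.2 ⊆ x.i.Ω y.1.1)
  (hV : ∀ (y : BSite L x) (z : Site d), z ∈ blockZd L y.1.1 y.1.2 → ∀ j, j ≤ x.m → z ∈ x.i.Ω j → j ≤ y.1.1)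

/-- the `γ = −3` block weight is positive (`1 ≤ L`, `0 < η`). [cite: Balaban1985BackgroundPropagators, (3.41) p.397 (the weights (Lʲη)^{−γ})] -/
theorem cubeWeight_pos (hL : 1 ≤ L) (v : BSite L x) : 0 < ((L : ℝ) ^ v.1.1 * x.i.η) ^ 3 :=
  pow_pos (B8ScaledSupNorm.scale_pos hL x.i.hη v.1.1) 3

include hT hV in
/-- ★★ **ENTRY n = 0 WITH PRINT'S UNIFORM CONSTANTS: `(Lʲη)·‖(G(U)f̃)(b)‖ ≤ B₀·L³·K261(N₀, d, L, 1, δ₀ − κ₂)·M`** whenever `(L^{j_y}η)³‖f(y)‖ ≤ M` on the class — (3.47)'s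
`|Gλ|_{(γ+2)} ≤ B₀c|λ|_{(γ)}` at `γ = −3` for the genuine `G(U)`, from (3.42) «using Lemma 2.1 of [4]»: exchange letter = `cube_exchange_of_connected` (`3 log L ≤ κ₂R⌈M⌉`),
row letter = `rowLetter261_hS` (`N₀ ≤ R⌈M⌉`, `e^{−(δ₀−κ₂)}L^{2d∕N₀} < 1`); finite member, connected block graph, `Sep22Zd R`, laws (T)(V).
[cite: Balaban1985BackgroundPropagators, (3.47) p.398 + l.17–20, (3.42) p.397; Balaban1984PropagatorsII, Lemma 2.1 (2.60)–(2.61) p.234, (2.59) p.233] -/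
theorem weight_mul_norm_gop_le_unif [Fintype (BSite L x)] (hL : 1 ≤ L) {R : ℕ} (hsep : Sep22Zd R x)
    (hconn : ∀ u v : BSite L x, (graphZd L x).Reachable u v) {ops : OpsZd d 𝔸} {U : CfgZd d 𝔸}
    {B₀ δ₀ : ℝ} (hB₀ : 0 ≤ B₀) (h342 : B9.Ineq342_346_347 (GAZdOfOps 𝔸 L len x ops) B₀ δ₀ U)
    (hlin : ∀ (c : ℝ) (A B : Site d → Fin d → 𝔸), ops.Gop U.1 (c • A + B) = c • ops.Gop U.1 A + ops.Gop U.1 B)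
    {P : Site d × Fin d → Prop} (π : {b : Site d × Fin d // P b} → BSite L x)
    (hπ : ∀ b, b.1.1 ∈ blockZd L (π b).1.1 (π b).1.2)
    {κ₂ : ℝ} (hκ₂ : 0 ≤ κ₂) (hrate : 3 * Real.log L ≤ κ₂ * ((R : ℝ) * ⌈x.M⌉₊))
    {N₀ : ℕ} (hN₀ : 0 < N₀) (hMN : N₀ ≤ R * ⌈x.M⌉₊) (hθ : Real.exp (-(δ₀ - κ₂)) * (L : ℝ) ^ ((2 * d : ℝ) / N₀) < 1)
    (f : {b : Site d × Fin d // P b} → 𝔸) {M : ℝ} (hM : 0 ≤ M) (hMf : ∀ y, ((L : ℝ) ^ (π y).1.1 * x.i.η) ^ 3 * ‖f y‖ ≤ M)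
    (b : {b : Site d × Fin d // P b}) :
    ((L : ℝ) ^ (π b).1.1 * x.i.η) * ‖ops.Gop U.1 (extZd P f) b.1.1 b.1.2‖ ≤
      B₀ * (L : ℝ) ^ 3 * K261 N₀ d L 1 (δ₀ - κ₂) * M :=
  weight_mul_norm_gop_le_of_ineq342 (len := len) hB₀ h342 hlin π hπ (κ₂ := κ₂) (by positivity)
    (ω := fun v : BSite L x => ((L : ℝ) ^ v.1.1 * x.i.η) ^ 3) (ω' := fun u : BSite L x => (L : ℝ) ^ u.1.1 * x.i.η)
    (cubeWeight_pos hL) (fun u => (B8ScaledSupNorm.scale_pos hL x.i.hη u.1.1).le)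
    (fun u v => by rw [mul_comm]; exact cube_exchange_of_connected hT hV hL hsep hconn hκ₂ hrate u v)
    (rowLetter261_hS hT hV hL hsep hconn hN₀ hMN hθ) f hM hMf b

include hT hV in
/-- ★ **ENTRY n = 1, UNIFORM: `(Lʲη)²·‖(∇_{U,ν}G(U)f̃)(b)‖ ≤ B₀·L³·K261(…)·M`** (every component `ν`; (3.47)'s `|∇_UGλ|_{(γ+1)}` at `γ = −3`).
[cite: Balaban1985BackgroundPropagators, (3.47) p.398 + l.17–20, (3.42) p.397; Balaban1984PropagatorsII, Lemma 2.1 (2.60)–(2.61) p.234] -/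
theorem weight_mul_norm_gradGop_le_unif [Fintype (BSite L x)] (hL : 1 ≤ L) {R : ℕ} (hsep : Sep22Zd R x)
    (hconn : ∀ u v : BSite L x, (graphZd L x).Reachable u v) {ops : OpsZd d 𝔸} {U : CfgZd d 𝔸}
    {B₀ δ₀ : ℝ} (hB₀ : 0 ≤ B₀) (h342 : B9.Ineq342_346_347 (GAZdOfOps 𝔸 L len x ops) B₀ δ₀ U)
    (hlin : ∀ (c : ℝ) (A B : Site d → Fin d → 𝔸), ops.Gop U.1 (c • A + B) = c • ops.Gop U.1 A + ops.Gop U.1 B)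
    {P : Site d × Fin d → Prop} (π : {b : Site d × Fin d // P b} → BSite L x)
    (hπ : ∀ b, b.1.1 ∈ blockZd L (π b).1.1 (π b).1.2)
    {κ₂ : ℝ} (hκ₂ : 0 ≤ κ₂) (hrate : 3 * Real.log L ≤ κ₂ * ((R : ℝ) * ⌈x.M⌉₊))
    {N₀ : ℕ} (hN₀ : 0 < N₀) (hMN : N₀ ≤ R * ⌈x.M⌉₊) (hθ : Real.exp (-(δ₀ - κ₂)) * (L : ℝ) ^ ((2 * d : ℝ) / N₀) < 1)
    (ν : Fin d) (f : {b : Site d × Fin d // P b} → 𝔸) {M : ℝ} (hM : 0 ≤ M) (hMf : ∀ y, ((L : ℝ) ^ (π y).1.1 * x.i.η) ^ 3 * ‖f y‖ ≤ M)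
    (b : {b : Site d × Fin d // P b}) :
    ((L : ℝ) ^ (π b).1.1 * x.i.η) ^ 2 * ‖cdBZd x.i.η U.1 ν (ops.Gop U.1 (extZd P f)) b.1.1 b.1.2‖ ≤
      B₀ * (L : ℝ) ^ 3 * K261 N₀ d L 1 (δ₀ - κ₂) * M :=
  weight_mul_norm_gradGop_le_of_ineq342 (len := len) hB₀ h342 hlin π hπ (κ₂ := κ₂) (by positivity)
    (ω := fun v : BSite L x => ((L : ℝ) ^ v.1.1 * x.i.η) ^ 3) (ω' := fun u : BSite L x => ((L : ℝ) ^ u.1.1 * x.i.η) ^ 2)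
    (cubeWeight_pos hL) (fun u => sq_nonneg _)
    (fun u v => cube_exchange_of_connected hT hV hL hsep hconn hκ₂ hrate u v)
    (rowLetter261_hS hT hV hL hsep hconn hN₀ hMN hθ) ν f hM hMf b

include hT hV in
/-- ★ **ENTRY n = 2, UNIFORM: `(Lʲη)²·‖(G(U)∇*_{U,ν}f̃)(b)‖ ≤ B₀·L³·K261(…)·M`** ((3.47)'s `|G∇*_Uλ|_{(γ+1)}` at `γ = −3`).
[cite: Balaban1985BackgroundPropagators, (3.47) p.398 + l.17–20, (3.42) p.397; Balaban1984PropagatorsII, Lemma 2.1 (2.60)–(2.61) p.234] -/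
theorem weight_mul_norm_gopDiv_le_unif [Fintype (BSite L x)] (hL : 1 ≤ L) {R : ℕ} (hsep : Sep22Zd R x)
    (hconn : ∀ u v : BSite L x, (graphZd L x).Reachable u v) {ops : OpsZd d 𝔸} {U : CfgZd d 𝔸}
    {B₀ δ₀ : ℝ} (hB₀ : 0 ≤ B₀) (h342 : B9.Ineq342_346_347 (GAZdOfOps 𝔸 L len x ops) B₀ δ₀ U)
    (hlin : ∀ (c : ℝ) (A B : Site d → Fin d → 𝔸), ops.Gop U.1 (c • A + B) = c • ops.Gop U.1 A + ops.Gop U.1 B)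
    {P : Site d × Fin d → Prop} (π : {b : Site d × Fin d // P b} → BSite L x)
    (hπ : ∀ b, b.1.1 ∈ blockZd L (π b).1.1 (π b).1.2)
    {κ₂ : ℝ} (hκ₂ : 0 ≤ κ₂) (hrate : 3 * Real.log L ≤ κ₂ * ((R : ℝ) * ⌈x.M⌉₊))
    {N₀ : ℕ} (hN₀ : 0 < N₀) (hMN : N₀ ≤ R * ⌈x.M⌉₊) (hθ : Real.exp (-(δ₀ - κ₂)) * (L : ℝ) ^ ((2 * d : ℝ) / N₀) < 1)
    (ν : Fin d) (f : {b : Site d × Fin d // P b} → 𝔸) {M : ℝ} (hM : 0 ≤ M) (hMf : ∀ y, ((L : ℝ) ^ (π y).1.1 * x.i.η) ^ 3 * ‖f y‖ ≤ M)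
    (b : {b : Site d × Fin d // P b}) :
    ((L : ℝ) ^ (π b).1.1 * x.i.η) ^ 2 * ‖ops.Gop U.1 (cdsBZd x.i.η U.1 ν (extZd P f)) b.1.1 b.1.2‖ ≤
      B₀ * (L : ℝ) ^ 3 * K261 N₀ d L 1 (δ₀ - κ₂) * M :=
  weight_mul_norm_gopDiv_le_of_ineq342 (len := len) hB₀ h342 hlin π hπ (κ₂ := κ₂) (by positivity)
    (ω := fun v : BSite L x => ((L : ℝ) ^ v.1.1 * x.i.η) ^ 3) (ω' := fun u : BSite L x => ((L : ℝ) ^ u.1.1 * x.i.η) ^ 2)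
    (cubeWeight_pos hL) (fun u => sq_nonneg _)
    (fun u v => cube_exchange_of_connected hT hV hL hsep hconn hκ₂ hrate u v)
    (rowLetter261_hS hT hV hL hsep hconn hN₀ hMN hθ) ν f hM hMf b

include hT hV in
/-- ★ **ENTRY n = 3, UNIFORM: `(Lʲη)³·‖(Δ_U G(U)f̃)(b)‖ ≤ B₀·L³·K261(…)·M`** ((3.47)'s `|Δ_UGλ|_{(γ)}` at `γ = −3`).
[cite: Balaban1985BackgroundPropagators, (3.47) p.398 + l.17–20, (3.42) p.397; Balaban1984PropagatorsII, Lemma 2.1 (2.60)–(2.61) p.234] -/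
theorem weight_mul_norm_lapGop_le_unif [Fintype (BSite L x)] (hL : 1 ≤ L) {R : ℕ} (hsep : Sep22Zd R x)
    (hconn : ∀ u v : BSite L x, (graphZd L x).Reachable u v) {ops : OpsZd d 𝔸} {U : CfgZd d 𝔸}
    {B₀ δ₀ : ℝ} (hB₀ : 0 ≤ B₀) (h342 : B9.Ineq342_346_347 (GAZdOfOps 𝔸 L len x ops) B₀ δ₀ U)
    (hlin : ∀ (c : ℝ) (A B : Site d → Fin d → 𝔸), ops.Gop U.1 (c • A + B) = c • ops.Gop U.1 A + ops.Gop U.1 B)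
    {P : Site d × Fin d → Prop} (π : {b : Site d × Fin d // P b} → BSite L x)
    (hπ : ∀ b, b.1.1 ∈ blockZd L (π b).1.1 (π b).1.2)
    {κ₂ : ℝ} (hκ₂ : 0 ≤ κ₂) (hrate : 3 * Real.log L ≤ κ₂ * ((R : ℝ) * ⌈x.M⌉₊))
    {N₀ : ℕ} (hN₀ : 0 < N₀) (hMN : N₀ ≤ R * ⌈x.M⌉₊) (hθ : Real.exp (-(δ₀ - κ₂)) * (L : ℝ) ^ ((2 * d : ℝ) / N₀) < 1)
    (f : {b : Site d × Fin d // P b} → 𝔸) {M : ℝ} (hM : 0 ≤ M) (hMf : ∀ y, ((L : ℝ) ^ (π y).1.1 * x.i.η) ^ 3 * ‖f y‖ ≤ M)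
    (b : {b : Site d × Fin d // P b}) :
    ((L : ℝ) ^ (π b).1.1 * x.i.η) ^ 3 * ‖lapBZd x.i.η U.1 (ops.Gop U.1 (extZd P f)) b.1.1 b.1.2‖ ≤
      B₀ * (L : ℝ) ^ 3 * K261 N₀ d L 1 (δ₀ - κ₂) * M :=
  weight_mul_norm_lapGop_le_of_ineq342 (len := len) hB₀ h342 hlin π hπ (κ₂ := κ₂) (by positivity)
    (ω := fun v : BSite L x => ((L : ℝ) ^ v.1.1 * x.i.η) ^ 3) (ω' := fun u : BSite L x => ((L : ℝ) ^ u.1.1 * x.i.η) ^ 3)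
    (cubeWeight_pos hL) (fun u => (cubeWeight_pos hL u).le)
    (fun u v => by rw [pow_succ]; exact cube_exchange_of_connected hT hV hL hsep hconn hκ₂ hrate u v)
    (rowLetter261_hS hT hV hL hsep hconn hN₀ hMN hθ) f hM hMf b

end Literature.MathematicalPhysics.QuantumFieldTheory.Balaban1983to89.B9Eq347GlobalFromLocalZdUniform

end
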